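import Summits.HodgeConjecture.CorCM.MumfordTateRankTypeIVThreefoldTimesCurves
import Summits.HodgeConjecture.CorCM.MumfordTateRankCMThreefoldTimesCurves
import HarnessLib

/-!
# The fivefold partition {1,1,3}, complete: `t(T × E₁ × E₂) ∈ {4, 5, 6, 7, 8, 10, 11, 12, 13, 14, 16, 23, 24, 25, 26, 28}` for EVERY simple complex
# abelian threefold `T` and ALL elliptic curves `E₁, E₂` (Moonen–Zarhin 1999, §§2–3)

COR-CM (cell `pub-hodgecm2`, seat `b27` gen 50, count-neutral Mumford–Tate-rank ladder; theorems only, no definition, no named fact;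
UNCONDITIONAL — nothing here uses or asserts HC_CM).  Notation `t(X) = dim MT(H¹X)`.

A simple abelian threefold has `dim_ℚ End⁰T ∈ {1, 2, 3, 6}` (`CorCM/MumfordTateRankSimpleThreefolds`: `t(T) = 22, 10, 10, 4`).  Row by row:
* `End⁰T = ℚ`                 : `{23, 24, 25, 26, 28}` (`CorCM/MumfordTateRankThreefoldTimesCurves`, `t(T) + 3a + b`);
* `End⁰T` a real cubic field  : `{11, 12, 13, 14, 16}` (ibid.);
* `End⁰T` imaginary quadratic : `{10, 11, 12, 13, 14, 16}` (`CorCM/MumfordTateRankTypeIVThreefoldTimesCurves`, gen 50: the CM curves add `0`, `1` or `2`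
  according to their fields against `End⁰T` and each other);
* `End⁰T` a sextic CM field   : `{4, 5, 6, 7, 8, 10}` (`CorCM/MumfordTateRankCMThreefoldTimesCurves`, gen 50, via seat b16's criterion).

* **`mtRank_hodge_one_mem_of_isIsogenous_isSimple_threefold_prod_curves`** — the union, for `X ∼ T × (E₁ × E₂)`.
With {2,3} (`…SurfaceTimesThreefold`), {1,2,2} (`…CurveTimesTwoSurfaces`), {2,1,1,1} (`…SurfaceTimesCurves`), {1,1,1,1,1} (`…ProductsOfCurves`), five of
the seven partitions of a non-simple abelian FIVEFOLD now have exact Mumford–Tate ranks in every cell; {1,4} and {5} wait for simple fourfolds/fivefolds.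

## References
* [MoonenZarhin1999LowDim] B. Moonen, Yu. G. Zarhin, *Hodge classes on abelian varieties of low dimension*, Math. Ann. 315 (1999), §2 (2.3), §3 (3.1),
  (3.4), (3.6), (3.8), Thm. 0.1, Thm. 0.2 [corpus: paper:arxiv-math_9901113 pp. 1–2, 5–7]. [cite: MoonenZarhin1999LowDim, §2 (2.3) and §3 (3.8)]
* [Gordon1999HodgeAVSurvey] B. B. Gordon, *A survey of the Hodge conjecture for abelian varieties*, §3, 7.5–7.7, 9.1. [cite: Gordon1999HodgeAVSurvey, 7.5 and 9.1]
* [MumfordAV1970] D. Mumford, *Abelian Varieties* (1970), §19 Cor. 2 of Thm. 1. [cite: MumfordAV1970, §19 Cor. 2 of Thm. 1]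
-/

noncomputable section

open CategoryTheory CategoryTheory.Limits Module

namespace Summit.HodgeConjecture.CorCM

open Literature.AlgebraicGeometry.Motives
open Literature.AlgebraicGeometry.Motives.AbelianVariety
open Literature.AlgebraicGeometry.Motives.HodgeStructure
open Literature.AlgebraicGeometry.HodgeTheory
open Literature.AlgebraicGeometry.Milne1999 (IsOfCMType)

variable [HodgeTensorFacts.{0, 0}] {X T E₁ E₂ : AbelianVariety ℂ} {n : ℕ}

/-- **The fivefold partition {1,1,3}: `t(T × E₁ × E₂) ∈ {4, 5, 6, 7, 8, 10, 11, 12, 13, 14, 16, 23, 24, 25, 26, 28}` for every SIMPLE complex abelian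
threefold `T` and all elliptic curves `E₁`, `E₂`** — by the endomorphism type of `T` (`dim_ℚ End⁰T = 1, 2, 3, 6`), each row exact in every cell (see the
header).  Every listed value occurs. [cite: MoonenZarhin1999LowDim, §2 (2.3) and §3 (3.8)] [cite: Gordon1999HodgeAVSurvey, 7.5 and 9.1] -/
theorem mtRank_hodge_one_mem_of_isIsogenous_isSimple_threefold_prod_curves (hX : IsSmoothProjective n X.X)
    (hTs : T.IsSimple) (hT3 : T.dim = 3) (hE₁1 : E₁.dim = 1) (hE₂1 : E₂.dim = 1) (hXP : IsIsogenous X (T.prod (E₁.prod E₂))) :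
    haveI := BettiUniverse.finite hX 1
    (BettiUniverse.hodge exists_isReal_hodgeModel_holds hX 1).mtRank ∈
      ({4, 5, 6, 7, 8, 10, 11, 12, 13, 14, 16, 23, 24, 25, 26, 28} : Finset ℕ) := by
  classical
  haveI := BettiUniverse.finite hX 1
  have hT : IsSmoothProjective T.dim T.X := AbelianVariety.isSmoothProjective_holds
  haveI := BettiUniverse.finite hT 1
  -- `X ∼ T × ⨁ ![E₁, E₂]` for the totally real rows
  have hXB : IsIsogenous X (T.prod (⨁ fun j : Fin 2 => (![E₁, E₂] : Fin 2 → AbelianVariety ℂ) j)) :=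
    hXP.trans ((IsIsogenous.refl T).prod (prod_isIsogenous_biproduct_two E₁ E₂))
  have hE : ∀ j : Fin 2, ((![E₁, E₂] : Fin 2 → AbelianVariety ℂ) j).dim = 1 := fun j => by
    fin_cases j
    · exact hE₁1
    · exact hE₂1
  have hreal := mtRank_hodge_one_mem_of_isIsogenous_threefold_totallyRealEnd_prod_biproduct_two_curves hX hTs hT3 hE hXB
  simp only [Finset.mem_insert, Finset.mem_singleton]
  rcases mtRank_hodge_one_of_isSimple_threefold hT hTs hT3 with ⟨h1, -⟩ | ⟨h2, -⟩ | ⟨h3, -⟩ | ⟨-, hcm, -⟩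
  · have h := hreal.1 h1
    simp only [Finset.mem_insert, Finset.mem_singleton] at h
    omega
  · have h := mtRank_hodge_one_mem_of_isIsogenous_typeIV_threefold_prod_curves hX hTs hT3 h2 hE₁1 hE₂1 hXP
    simp only [Finset.mem_insert, Finset.mem_singleton] at h
    omega
  · have h := hreal.2 h3
    simp only [Finset.mem_insert, Finset.mem_singleton] at h
    omega
  · have h := mtRank_hodge_one_mem_of_isIsogenous_cmThreefold_prod_curves hX hTs hT3 hcm hE₁1 hE₂1 hXP
    simp only [Finset.mem_insert, Finset.mem_singleton] at h
    omega

end Summit.HodgeConjecture.CorCM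

end
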